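import Literature.NumberTheory.Automorphic.AdeleGaloisDescent
import Literature.NumberTheory.Automorphic.Sweep1BaseChangeProofs
import Literature.NumberTheory.Automorphic.ArthurClozelBaseChange
import Literature.NumberTheory.Automorphic.PairLFunctionPolesGLOneProofs
import Literature.NumberTheory.LFunctions.AutomorphicGRHProofs
import Mathlib.RingTheory.DedekindDomain.Different
import Mathlib.NumberTheory.RamificationInertia.Unramified
import Mathlib.NumberTheory.RamificationInertia.Galois
import HarnessLib

/-!
# lang.S23 in rank one: base change for `GL(1)`, `χ ↦ χ ∘ N_{E/F}` (proof file under `Sweep1`)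

Topic `NumberTheory/Automorphic`; sibling proof file (theorems and two definitions, no named
fact, no instance) of `Sweep1` under its named fact
`Literature.NumberTheory.Automorphic.exists_cuspidal_baseChange_of_not_dvd` (**lang.S23**,
Arthur–Clozel (1989), Ch. 3, Thm. 4.2 (a) with Thm. 5.1: for `E/F` cyclic of prime degree `ℓ ∤ n`,
every cuspidal `π` on `GL_n(𝔸_F)` has a cuspidal base change `Π` on `GL_n(𝔸_E)` with
`t_{Π,w} = t_{π,v}^{f(w|v)}` at almost all `w`). For general `n` the fact is equivalent
(`Sweep1BaseChangeProofs`) to the tree's rendering of Thm. 4.2 (a)–(b), whose printed proof is the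
comparison of trace formulae; this file **proves the fact outright in rank `n = 1`**, where base
change is `χ ↦ χ ∘ N_{E/F}` on idele class characters — relation (1.1) of op. cit. Ch. 3, §1,
`t_{Π,w} = (t_{π,v})^{f_v}`, holds for `χ ∘ N_{E/F}` because `N_{E/F}` takes a uniformizer at an
unramified `w` to `ϖ_v^{f_v}` times a unit. This is also the base `n = 1` of Arthur–Clozel's
induction on `n` (op. cit. Ch. 3, §4, proof of Thm. 4.2: "We assume all statements of Theorem 4.2
known up to `n - 1`").

## What is proved

* `HeckeCharacter.baseChange E χ = χ ∘ N_{E/F}` (**definition**; the idelic norm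
  `AdeleRing.ideleRelNorm` and its continuity, `N(Eˣ) ⊆ Fˣ`, are `AdeleGaloisDescent`), unitary with
  `χ`, `χ_E(z_E(t)) = χ(z_F(t^{[E:F]}))`, and **`χ_E(⟨u⟩_{w}) = χ(⟨u⟩_v)^{e_v f_v}`** for `u ∈ F_vˣ`
  viewed in `E_w` (`baseChange_localUnits`) — relation (1.1) in rank one.
* `GLOne.exists_level_eigenvalue_eq_one` — every irreducible `W ≤ L²(GL_1(𝔸_K) ⧸ ℝ_{>0} Kˣ)` has a
  level `K(𝔑)`, `𝔑 ≠ 0`, fixing all of `W` (continuity of the eigencharacter, the tree's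
  `exists_principalCongruenceLevel_subset`, no small subgroups of `ℂˣ`);
  `GLOne.hasSatakeParameterAt_singleton` — then `W` has Satake parameter `{χ_W(ϖ at w)}` at every
  `w` with respect to `K(𝔑)` (converse of `HasSatakeParameterAt.eq_singleton_heckeCharacter`).
* `eventually_ramificationIdx_eq_one` — `E/F` is unramified at all but finitely many places
  (Mathlib's different ideal).
* **`exists_cuspidal_baseChange_of_not_dvd_one : exists_cuspidal_baseChange_of_not_dvd (n := 1)`** —
  lang.S23 in rank one, for every finite Galois `E/F` of prime degree as the fact demands (the
  proof uses only "finite Galois"): `Π` is the line of `L²_cusp(GL_1(𝔸_E) ⧸ ℝ_{>0} Eˣ)` with Hecke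
  character `χ_π ∘ N_{E/F}` (`exists_cuspidalAutomorphicRepGL_heckeCharacter_eq` of
  `LFunctions/AutomorphicGRHProofs`, any automorphic measure, `exists_isAutomorphicMeasure_gl_one`),
  with levels from Flath's theorem over `F` (`exists_hasSatakeParameterAt_cofinite_holds`) and
  `GLOne.exists_level_eigenvalue_eq_one` over `E`; at the cofinitely many `w` where `π` has a Satake
  parameter `{χ_π(ϖ_v)}` below `w`, the levels are prime to `w`, and `e(w|v) = 1`, the image of
  `ϖ_v` is a uniformizer of `E_w` and `t_{Π,w} = {χ_π(N ϖ_v)} = {χ_π(ϖ_v)^{f(w|v)}}`.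
* Consequence: `arthurClozel1989_exists_cuspidal_weakLift_or_dvd_one` (the named fact
  `ArthurClozel1989_exists_cuspidal_weakLift_or_dvd` of `Sweep1Proofs` for `n = 1`); since `ℓ ∤ 1`,
  this is the existence-and-cuspidality clause of Thm. 4.2 (a) in rank one for every cuspidal `π`,
  from which `Sweep1BaseChangeGLOneAssembly` assembles `ArthurClozel1989_weakLifting_cuspidal 1 F E`
  (Thm. 4.2 (a) in full, `ArthurClozelBaseChange`).

No statement of the tree is modified; no named fact is introduced; the two named facts above
keep their general-`n` meaning and remain undischarged for `n ≥ 2` (trace formula).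

## References

* J. Arthur, L. Clozel, *Simple algebras, base change, and the advanced theory of the trace
  formula*, Ann. of Math. Stud. 120 (1989), Ch. 3, §1 (Def. 1.1, (1.1)), Thm. 4.2 (a), Thm. 5.1,
  and §4, proof of Thm. 4.2 (induction on `n`). [ArthurClozelAMS120]
* J. Tate, *Fourier analysis in number fields and Hecke's zeta-functions* (1950), Lemma 3.2.1,
  §4.3, in Cassels–Fröhlich (1967), Ch. XV. [TateThesis1967]
* J. Neukirch, *Algebraic Number Theory* (1999), Ch. III, Thm. (2.6) (different and
  ramification). [NeukirchANT1999]
-/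

noncomputable section

open scoped MatrixGroups NNReal
open NumberField IsDedekindDomain MeasureTheory Filter Topology

namespace Literature.NumberTheory.Automorphic

/-! ### Base change of Hecke characters: `χ ↦ χ ∘ N_{E/F}` -/

section HeckeCharacterBaseChange

variable {F : Type} (E : Type) [Field F] [Field E] [Algebra F E] [NumberField F] [NumberField E]
  [IsGalois F E]

/-- **Base change of Hecke characters** `χ ↦ χ_E = χ ∘ N_{E/F}` along a finite Galois extension
`E/F`: the composite of `χ : 𝕀_F → ℂˣ` with the (continuous) idelic norm
`AdeleRing.ideleRelNorm F E : 𝕀_E → 𝕀_F`; it is trivial on `Eˣ` because `N_{E/F}(Eˣ) ⊆ Fˣ`.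
This is base change for `GL(1)`: `χ_E` is the weak base-change lift of `χ` in the sense of
Arthur–Clozel, Ch. 3, §1, Def. 1.1 (relation (1.1) `t_{Π,w} = (t_{π,v})^{f_v}`, by
`baseChange_localUnits` below). [cite: ArthurClozelAMS120, Ch. 3, §1 Def. 1.1] -/
def _root_.Literature.NumberTheory.GaloisRepresentations.HeckeCharacter.baseChange
    (χ : GaloisRepresentations.HeckeCharacter F) : GaloisRepresentations.HeckeCharacter E where
  toContinuousMonoidHom :=
    { toMonoidHom := χ.toContinuousMonoidHom.toMonoidHom.comp (AdeleRing.ideleRelNorm F E)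
      continuous_toFun :=
        χ.toContinuousMonoidHom.continuous.comp (AdeleRing.continuous_ideleRelNorm F E) }
  map_principal' _ hy := χ.map_principal' _ (AdeleRing.ideleRelNorm_mem_principalIdeles F E hy)

/-- `χ_E(y) = χ(N_{E/F} y)` (definitional). [folklore] -/
@[simp] theorem _root_.Literature.NumberTheory.GaloisRepresentations.HeckeCharacter.baseChange_apply
    (χ : GaloisRepresentations.HeckeCharacter F) (y : GaloisRepresentations.ideleGroup E) :
    χ.baseChange E y = χ (AdeleRing.ideleRelNorm F E y) := rfl

/-- `χ_E` is unitary when `χ` is. [folklore] -/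
theorem _root_.Literature.NumberTheory.GaloisRepresentations.HeckeCharacter.IsUnitary.baseChange
    {χ : GaloisRepresentations.HeckeCharacter F} (hχ : χ.IsUnitary) : (χ.baseChange E).IsUnitary :=
  fun _ => hχ _

/-- `χ_E` is `Gal(E/F)`-invariant: `χ_E(σ y) = χ_E(y)` (`N_{E/F}(σ y) = N_{E/F}(y)`); in rank one
the base-change lift is `σ`-stable, as in Arthur–Clozel, Ch. 3, Thm. 4.2 (a). [folklore] -/
theorem _root_.Literature.NumberTheory.GaloisRepresentations.HeckeCharacter.baseChange_smul
    (χ : GaloisRepresentations.HeckeCharacter F) (σ : E ≃ₐ[F] E)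
    (y : GaloisRepresentations.ideleGroup E) : χ.baseChange E (σ • y) = χ.baseChange E y := by
  rw [GaloisRepresentations.HeckeCharacter.baseChange_apply,
    GaloisRepresentations.HeckeCharacter.baseChange_apply, AdeleRing.ideleRelNorm_smul]

/-- `χ_E` on the ideles of `F`: `χ_E(x_E) = χ(x)^{[E:F]}` (`N_{E/F}(x_E) = x^{[E:F]}`). [folklore] -/
theorem _root_.Literature.NumberTheory.GaloisRepresentations.HeckeCharacter.baseChange_ideleBaseChange
    (χ : GaloisRepresentations.HeckeCharacter F) (x : GaloisRepresentations.ideleGroup F) :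
    χ.baseChange E (AdeleRing.ideleBaseChange F E x) = χ x ^ Fintype.card (E ≃ₐ[F] E) := by
  rw [GaloisRepresentations.HeckeCharacter.baseChange_apply, AdeleRing.ideleRelNorm_ideleBaseChange,
    map_pow]

/-- `χ_E` on the positive real ideles: `χ_E(z_E(t)) = χ(z_F(t ^ [E:F]))`
(`AdeleRing.ideleRelNorm_posRealIdele`). [folklore] -/
theorem _root_.Literature.NumberTheory.GaloisRepresentations.HeckeCharacter.baseChange_posRealIdele
    (χ : GaloisRepresentations.HeckeCharacter F) (t : ℝ≥0ˣ) :
    χ.baseChange E (posRealIdele E t) = χ (posRealIdele F (t ^ Fintype.card (E ≃ₐ[F] E))) := by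
  rw [GaloisRepresentations.HeckeCharacter.baseChange_apply, AdeleRing.ideleRelNorm_posRealIdele]

/-- **The base-changed character at a local idele above `v`**: for `w₀ ∣ v` and `u ∈ F_vˣ` viewed
in `E_{w₀}`, `χ_E(⟨u⟩_{w₀}) = χ(⟨u⟩_v)^{e_v f_v}` (`AdeleRing.ideleRelNorm_localUnits`): the
unramified computation `χ_E(ϖ_w) = χ(ϖ_v)^{f}` behind Arthur–Clozel's (1.1) in rank one.
[cite: ArthurClozelAMS120, Ch. 3, §1 (1.1)] -/
theorem _root_.Literature.NumberTheory.GaloisRepresentations.HeckeCharacter.baseChange_localUnits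
    (χ : GaloisRepresentations.HeckeCharacter F) (v : HeightOneSpectrum (𝓞 F))
    (u : (v.adicCompletion F)ˣ) (c : ∀ w : HeightOneSpectrum (𝓞 E), (w.adicCompletion E)ˣ)
    (hc : ∀ (w : HeightOneSpectrum (𝓞 E)) (_ : w.under (𝓞 F) = v) [w.asIdeal.LiesOver v.asIdeal],
      (c w : w.adicCompletion E) = adicCompletionOfLiesOver F E v w (u : v.adicCompletion F))
    {w₀ : HeightOneSpectrum (𝓞 E)} (hw₀ : w₀.under (𝓞 F) = v) :
    χ.baseChange E (GaloisRepresentations.localUnits w₀ (c w₀)) =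
      χ (GaloisRepresentations.localUnits v u) ^
        (v.asIdeal.ramificationIdxIn (𝓞 E) * v.asIdeal.inertiaDegIn (𝓞 E)) := by
  rw [GaloisRepresentations.HeckeCharacter.baseChange_apply,
    AdeleRing.ideleRelNorm_localUnits F E v u c hc hw₀, map_pow]

end HeckeCharacterBaseChange

/-! ### Levels and Satake parameters of the lines in `L²(GL_1)` -/

section GLOneLevel

variable {K : Type} [Field K] [NumberField K]
  {μ : Measure (AdelicGroupData.gl 1 K).automorphicQuotient}
  [(AdelicGroupData.gl 1 K).IsAutomorphicMeasure μ]
  {W : ContRepresentation.ClosedSubrep ((AdelicGroupData.gl 1 K).rightRegular μ)}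

/-- **Every irreducible `W ≤ L²(GL_1(𝔸_K) ⧸ ℝ_{>0} Kˣ)` has a level**: there is a non-zero ideal
`𝔑` with `ω_W = 1` on the principal congruence subgroup `K(𝔑)`, i.e. every vector of `W` is
`K(𝔑)`-fixed. Proof: the eigencharacter `ω_W` is continuous (`GLOne.continuous_eigenvalue`), so
`ω_W⁻¹ {|z - 1| < 1/2}` is a neighbourhood of `1`, which contains some `K(𝔑)`
(`exists_principalCongruenceLevel_subset`); the subgroup `ω_W(K(𝔑)) ⊆ {|z - 1| < 1/2}` is trivial
("no small subgroups", `HeckeCharacter.eq_one_of_norm_pow_sub_one_le`). This is the rank-one case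
of "cuspidal representations have a conductor" (Tate (1950), Lemma 3.2.1 / §4.3 for
quasi-characters). [folklore] -/
theorem GLOne.exists_level_eigenvalue_eq_one (hW : W.toContRep.IsTopIrreducible) :
    ∃ 𝔑 : Ideal (𝓞 K), 𝔑 ≠ 0 ∧
      ∀ k ∈ principalCongruenceLevel 1 K 𝔑, GLOne.eigenvalue hW k = 1 := by
  set U : Set (AdelicGroupData.gl 1 K).Adelic :=
    GLOne.eigenvalue hW ⁻¹' Metric.ball (1 : ℂ) (1 / 2) with hU
  have hUn : U ∈ 𝓝 (1 : (AdelicGroupData.gl 1 K).Adelic) := by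
    refine (GLOne.continuous_eigenvalue hW).continuousAt.preimage_mem_nhds ?_
    rw [GLOne.eigenvalue_one]
    exact Metric.ball_mem_nhds _ (by norm_num)
  obtain ⟨𝔑, h𝔑, hsub⟩ := exists_principalCongruenceLevel_subset 1 K hUn
  refine ⟨𝔑, h𝔑, fun k hk => ?_⟩
  refine GaloisRepresentations.HeckeCharacter.eq_one_of_norm_pow_sub_one_le
    (c := 1 / 2) (by norm_num) fun m => ?_
  have hkm : GLOne.eigenvalue hW (k ^ m) ∈ Metric.ball (1 : ℂ) (1 / 2) := hsub (pow_mem hk m)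
  have hpow : GLOne.eigenvalue hW (k ^ m) = GLOne.eigenvalue hW k ^ m :=
    map_pow (GLOne.eigenvalueHom hW) k m
  rw [hpow] at hkm
  exact (mem_ball_iff_norm.1 hkm).le

/-- **Satake parameters of a line in `L²(GL_1)`**: if `ω_W = 1` on `K(𝔑)`, then at every finite
place `w` and for every uniformizer `ϖ` of `K_w`, `W` has the Satake parameter `{χ_W(ϖ at w)}`
with respect to `K(𝔑)`: any `0 ≠ f ∈ W` is `K(𝔑)`-fixed, `T_{w,0} f = f`, and
`T_{w,1} f = R(t_{w,1}) f = χ_W(⟨ϖ⟩_w) f` (`heckeOperatorAt_eq_toContRep_apply`,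
`heckeDiagAt_one_one_eq_scalar`). [folklore] -/
theorem GLOne.hasSatakeParameterAt_singleton (hW : W.toContRep.IsTopIrreducible) {𝔑 : Ideal (𝓞 K)}
    (h𝔑 : ∀ k ∈ principalCongruenceLevel 1 K 𝔑, GLOne.eigenvalue hW k = 1)
    (w : HeightOneSpectrum (𝓞 K)) {ϖ : (w.adicCompletion K)ˣ}
    (hϖ : Valued.v (ϖ : w.adicCompletion K) = WithZero.exp (-1 : ℤ)) :
    HasSatakeParameterAt W (principalCongruenceLevel 1 K 𝔑) w ϖ
      {((GLOne.heckeCharacter hW (GaloisRepresentations.localUnits w ϖ) : ℂˣ) : ℂ)} := by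
  obtain ⟨f, hf0⟩ := GLOne.exists_ne_zero hW
  have hfK : f ∈ W.fixedVectors (principalCongruenceLevel 1 K 𝔑) := by
    rw [ContRepresentation.ClosedSubrep.mem_fixedVectors]
    intro k hk
    rw [GLOne.toContRep_apply_eq_eigenvalue_smul hW k f, h𝔑 k hk, one_smul]
  refine ⟨hϖ, by simp, f, hfK, hf0, fun i hi => ?_⟩
  rcases Nat.le_one_iff_eq_zero_or_eq_one.1 hi with rfl | rfl
  · rw [heckeDiagAt_zero, heckeOperatorAt_eq_toContRep_apply W _ _ hfK]
    change W.toContRep (1 : (AdelicGroupData.gl 1 K).Adelic) f = _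
    rw [map_one]
    simp [Multiset.esymm]
  · rw [heckeOperatorAt_eq_toContRep_apply W _ _ hfK, GLOne.heckeDiagAt_one_one_eq_scalar,
      GLOne.toContRep_apply_eq_eigenvalue_smul hW, GLOne.coe_heckeCharacter_apply]
    congr 1
    simp [Multiset.esymm, Multiset.powersetCard_one]

end GLOneLevel

/-! ### Unramified almost everywhere -/

section Unramified

variable (F E : Type) [Field F] [Field E] [Algebra F E] [NumberField F] [NumberField E]

/-- **`E/F` is unramified at all but finitely many places**: `e(w | w ∩ 𝓞 F) = 1` for all `w`
not dividing the relative different (Mathlib `not_dvd_differentIdeal_iff`,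
`Ideal.ramificationIdx_eq_one_of_isUnramifiedAt`; finitely many primes divide the non-zero
different, `Ideal.finite_factors`). Dedekind's different theorem, Neukirch Ch. III (2.6).
[cite: NeukirchANT1999, Ch. III Thm. (2.6)] -/
theorem eventually_ramificationIdx_eq_one :
    ∀ᶠ w : HeightOneSpectrum (𝓞 E) in cofinite, w.asIdeal.ramificationIdx (𝓞 F) = 1 := by
  have h0 : differentIdeal (𝓞 F) (𝓞 E) ≠ ⊥ := differentIdeal_ne_bot
  refine (Ideal.finite_factors h0).subset fun w hw => ?_
  by_contra hnd
  apply hw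
  haveI : Algebra.IsUnramifiedAt (𝓞 F) w.asIdeal := not_dvd_differentIdeal_iff.mp hnd
  exact Ideal.ramificationIdx_eq_one_of_isUnramifiedAt

end Unramified

/-! ### lang.S23 in rank one -/

section RankOne

variable {F E : Type} [Field F] [NumberField F] [Field E] [NumberField E] [Algebra F E]

/-- **lang.S23 holds in rank `n = 1` (cyclic — indeed any finite Galois — base change for
`GL(1)`): the named fact `exists_cuspidal_baseChange_of_not_dvd` of `Sweep1` for `n = 1`.**
Given a cuspidal automorphic representation `π` of `GL_1(𝔸_F)` — a line `ℂ χ̄` for the unitary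
Hecke character `χ = χ_π` trivial on `ℝ_{>0}` (`CuspidalAutomorphicRepGL.heckeCharacter`,
`GLOneStandardLTate`) — its base change is the cuspidal automorphic representation `Π` of
`GL_1(𝔸_E)` with Hecke character `χ_E = χ ∘ N_{E/F}` (`HeckeCharacter.baseChange`; it exists in
`L²_cusp(GL_1(𝔸_E) ⧸ ℝ_{>0} Eˣ)` by `exists_cuspidalAutomorphicRepGL_heckeCharacter_eq`, `χ_E`
being unitary and trivial on `ℝ_{>0}` as `N(z_E(t)) = z_F(t^{[E:F]})`). Levels: a level `𝔫` of
`π` from Flath's theorem (`exists_hasSatakeParameterAt_cofinite_holds`) and a level `𝔑` of `Π`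
(`GLOne.exists_level_eigenvalue_eq_one`). At all but finitely many `w` — those with `w ∩ 𝓞 F ∤ 𝔫`,
`w ∤ 𝔑`, `π` having a Satake parameter `α = {χ(ϖ_v)}` at `v = w ∩ 𝓞 F`, and `E/F` unramified at
`w` (`eventually_ramificationIdx_eq_one`) — the image `ϖ'` of `ϖ_v` in `E_w` is a uniformizer and
`Π` has Satake parameter `{χ_E(ϖ'_w)} = {χ(ϖ_v)^{f(w|v)}} = α^{f}` at `w`
(`HeckeCharacter.baseChange_localUnits`: `N_{E/F}(⟨ϖ_v⟩_w) = ⟨ϖ_v⟩_v^{e f}` with `e = 1`). This is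
the case `n = 1` of Arthur–Clozel, Ch. 3, Thm. 4.2 (a) with Thm. 5.1 — the base of their
induction on `n` (§4, proof of Thm. 4.2: "We assume all statements of Theorem 4.2 known up to
`n - 1`") — here obtained without the trace formula and without class field theory.
[cite: ArthurClozelAMS120, Ch. 3, Thm. 4.2 (a) and §1 (1.1)] -/
theorem exists_cuspidal_baseChange_of_not_dvd_one :
    exists_cuspidal_baseChange_of_not_dvd (n := 1) (F := F) (E := E) := by
  intro _ _ _ μ _ P
  classical
  -- the automorphic measure on the `E` side and the lift `Π = ℂ · (χ ∘ N)⁻`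
  obtain ⟨ν, hν⟩ := AdelicGroupData.exists_isAutomorphicMeasure_gl_one E
  haveI := hν
  have hu : (P.heckeCharacter.baseChange E).IsUnitary := P.isUnitary_heckeCharacter.baseChange E
  have h0 : ∀ t, P.heckeCharacter.baseChange E (posRealIdele E t) = 1 := fun t => by
    rw [GaloisRepresentations.HeckeCharacter.baseChange_posRealIdele, P.heckeCharacter_posRealIdele]
  obtain ⟨Q, hQ⟩ :=
    LFunctions.AutomorphicGRHOne.exists_cuspidalAutomorphicRepGL_heckeCharacter_eq ν
      (P.heckeCharacter.baseChange E) hu h0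
  -- levels
  obtain ⟨𝔫, h𝔫, hP⟩ := exists_hasSatakeParameterAt_cofinite_holds (n := 1) (K := F) (μ := μ) P
  obtain ⟨𝔑, h𝔑, hQK⟩ := GLOne.exists_level_eigenvalue_eq_one Q.isTopIrreducible
  refine ⟨ν, hν, Q, 𝔫, h𝔫, 𝔑, h𝔑, ?_⟩
  -- four cofinite sets of places of `E`
  have h1 : ∀ᶠ w : HeightOneSpectrum (𝓞 E) in cofinite, ¬ (w.under (𝓞 F)).asIdeal ∣ 𝔫 :=
    (tendsto_under_cofinite (𝓞 F)).eventually (Ideal.finite_factors h𝔫).compl_mem_cofinite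
  have h2 : ∀ᶠ w : HeightOneSpectrum (𝓞 E) in cofinite,
      ∃ (ϖ : ((w.under (𝓞 F)).adicCompletion F)ˣ) (α : Multiset ℂ),
        HasSatakeParameterAt P.1 (principalCongruenceLevel 1 F 𝔫) (w.under (𝓞 F)) ϖ α :=
    (tendsto_under_cofinite (𝓞 F)).eventually hP
  have h3 : ∀ᶠ w : HeightOneSpectrum (𝓞 E) in cofinite, ¬ w.asIdeal ∣ 𝔑 :=
    (Ideal.finite_factors h𝔑).compl_mem_cofinite
  have h4 := eventually_ramificationIdx_eq_one F E
  filter_upwards [h1, h2, h3, h4] with w hw1 hw2 hw3 hw4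
  obtain ⟨ϖ, α, hα⟩ := hw2
  -- the uniformizer `ϖ' = ϖ_v ∈ E_w` and the norm computation (`v = w ∩ 𝓞 F`)
  haveI iw : w.asIdeal.LiesOver (w.under (𝓞 F)).asIdeal := ⟨rfl⟩
  obtain ⟨c, hc, -⟩ := exists_localUnitsAbove E (w.under (𝓞 F)) ϖ
  have he' : (w.under (𝓞 F)).asIdeal.ramificationIdx' w.asIdeal = 1 := by
    rw [Ideal.ramificationIdx'_eq_ramificationIdx (w.under (𝓞 F)).asIdeal w.asIdeal
      (w.under (𝓞 F)).ne_bot, hw4]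
  have heIn : (w.under (𝓞 F)).asIdeal.ramificationIdxIn (𝓞 E) = 1 := by
    rw [Ideal.ramificationIdxIn_eq_ramificationIdx (w.under (𝓞 F)).asIdeal w.asIdeal (E ≃ₐ[F] E),
      hw4]
  have hfIn : (w.under (𝓞 F)).asIdeal.inertiaDegIn (𝓞 E) = w.asIdeal.inertiaDeg (𝓞 F) :=
    Ideal.inertiaDegIn_eq_inertiaDeg (w.under (𝓞 F)).asIdeal w.asIdeal (E ≃ₐ[F] E)
  have hϖ' : Valued.v ((c w : (w.adicCompletion E)ˣ) : w.adicCompletion E) =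
      WithZero.exp (-1 : ℤ) := by
    rw [hc w rfl, valued_adicCompletionOfLiesOver, he', pow_one, hα.1]
  refine ⟨hw1, hw3, ϖ, c w, α, hα, ?_⟩
  -- `α = {χ(ϖ_v)}` and the Satake parameter of `Π` at `w`
  have hαeq := hα.eq_singleton_heckeCharacter P.isTopIrreducible
  have hQsat := GLOne.hasSatakeParameterAt_singleton Q.isTopIrreducible hQK w hϖ'
  have hval : ((GLOne.heckeCharacter Q.isTopIrreducible
      (GaloisRepresentations.localUnits w (c w)) : ℂˣ) : ℂ) =
      ((GLOne.heckeCharacter P.isTopIrreducible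
        (GaloisRepresentations.localUnits (w.under (𝓞 F)) ϖ) : ℂˣ) : ℂ) ^
        w.asIdeal.inertiaDeg (𝓞 F) := by
    change ((Q.heckeCharacter (GaloisRepresentations.localUnits w (c w)) : ℂˣ) : ℂ) =
      ((P.heckeCharacter (GaloisRepresentations.localUnits (w.under (𝓞 F)) ϖ) : ℂˣ) : ℂ) ^ _
    rw [hQ, GaloisRepresentations.HeckeCharacter.baseChange_localUnits E P.heckeCharacter
      (w.under (𝓞 F)) ϖ c hc rfl, heIn, one_mul, hfIn, Units.val_pow_eq_pow_val]
  rw [hαeq, Multiset.map_singleton, ← hval]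
  exact hQsat

/-- **Arthur–Clozel, Ch. 3, Thm. 4.2 (a)–(b) in rank one**: the named fact
`ArthurClozel1989_exists_cuspidal_weakLift_or_dvd` ("cuspidal weak lift, or `ℓ ∣ n`") for `n = 1`,
from `exists_cuspidal_baseChange_of_not_dvd_one` through the proved equivalence
`arthurClozel1989_exists_cuspidal_weakLift_or_dvd_of_baseChange` (`Sweep1BaseChangeProofs`).
[cite: ArthurClozelAMS120, Ch. 3, Thm. 4.2 (a)] -/
theorem arthurClozel1989_exists_cuspidal_weakLift_or_dvd_one :
    ArthurClozel1989_exists_cuspidal_weakLift_or_dvd (n := 1) (F := F) (E := E) :=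
  arthurClozel1989_exists_cuspidal_weakLift_or_dvd_of_baseChange
    exists_cuspidal_baseChange_of_not_dvd_one

end RankOne

end Literature.NumberTheory.Automorphic
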